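import Literature.AnabelianGeometry.SemiGraphs.SubgroupPresentationConjForm
import HarnessLib

/-!
# [SemiAnbd] Thm 5.4, producer row T54-B: EDGE CONJUGATORS of a subgroup presentation from the
# branch-granular PAIR TRANSPORT (the `hE` input of `IsArithCompatible.of_conj`, generic algebra)

Mochizuki, *Semi-graphs of anabelioids*, Publ. RIMS **42** (2006), §5 p. 65 ll. 4–14 (the decomposition
groups `Π^temp_{𝔊,v}`, `Π^temp_{𝔊,b}` "well-defined up to conjugation"), Def 5.1 (i) p. 62 (`ρ_𝒢(a)` is an
automorphism of the semi-graph of anabelioids, compatible with the `b_*` up to conjugation, Rmk 2.4.2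
p. 26), Thm 3.7 (iii) p. 41 (a nontrivial compact subgroup lies in at most two verticial subgroups),
Thm 5.4 p. 66 [cite: MochizukiSemiAnbd2006, §5, p. 65].  abc-iut cell, layer L3, GAP-LEDGER row
G-w4d053-1 (T54-B), sub-piece «hEc-inst» (seat abc-iut-w4-d053 gen 3).  PROOF-ONLY, pure algebra over
abc-iut-L3-d4's `SemiGraph.SubgroupPresentation` (no definition, no named fact).

abc-iut-L3-d4's conjugation-form constructor `IsArithCompatible.of_conj` (SubgroupPresentationConjForm,
p427671) takes the EDGE input

  `hE : ∀ e ε, ∃ m, Φ_e(M_ε) ≤ m M_{σ_e ε} m⁻¹ ∧ ∀ b : ε → w, ∃ k, Φ_e(H_w) = k H_{σ_e w} k⁻¹ ∧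
        s_{σ_e b} · m⁻¹ · Φ_e(s_b)⁻¹ · k ∈ H_{σ_e w}`

(an edge conjugator `m` COMPATIBLE WITH THE BRANCH ELEMENTS at both ends).  This file DERIVES it
(`exists_edgeConj_of_pairTransport`) from:

* `hBR` — PAIR TRANSPORT at one branch: for every `e` and every branch `b : ε → w` there is `k` with
  `Φ_e(H_w) = k H_{σ_e w} k⁻¹` AND `Φ_e(s_b M_ε s_b⁻¹) = k (s_{σ_e b} M_{σ_e ε} s_{σ_e b}⁻¹) k⁻¹` — the
  branch-granular reading (BR) of Def 5.1 (i) (abc-iut-w4-d082's `conj_branchPair_outerAction` for the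
  outer semi-direct product, once the presentation's positioned branch groups `s_b M_ε s_b⁻¹` are
  identified with the decomposition images of the branch subgroups `Π_b ⊆ Π_w`);
* `hV` — vertex conjugators in conjugation form (abc-iut-w4-d082's
  `piPresentation_exists_isVConj_outerAction` with `isVConj_iff_map_eq`);
* `hTwo` — a conjugate vertex group `g H_w g⁻¹` containing `M_ε` is one of the two POSITIONED END GROUPS
  `s_{b₁}⁻¹ H_{w₁} s_{b₁}`, `s_{b₂}⁻¹ H_{w₂} s_{b₂}` of `ε` (Thm 3.7 (iii): at most two verticial hosts);
* `hNe` — the two positioned end groups of an edge are distinct (an edge group is not a vertex group);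
* every branch abuts (`𝔾` is a graph, Thm 5.4).

CONSTRUCTION: pick a branch `b₁ : ε → w₁`; `hBR` gives `k₁`; put `m := Φ_e(s_{b₁})⁻¹ · k₁ · s_{σ_e b₁}`.
Then `Φ_e(M_ε) = m M_{σ_e ε} m⁻¹` (`map_M_eq_of_pairTransport`) and the branch clause at `b₁` holds with
`k₁` (the element is `1`).  For the other branch `b₂ : ε → w₂` put `k* := Φ_e(s_{b₂}) · m · s_{σ_e b₂}⁻¹`:
`m⁻¹ Φ_e(s_{b₂}⁻¹ H_{w₂} s_{b₂}) m` is a conjugate of `H_{σ_e w₂}` (`hV`) containing `M_{σ_e ε}`, hence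
(`hTwo`) a positioned end group of `σ_e ε`, and not the `σ_e b₁`-end — that one is
`m⁻¹ Φ_e(s_{b₁}⁻¹ H_{w₁} s_{b₁}) m` and `Φ_e`, conjugation are injective on subgroups (`hNe`) —, so it is
the `σ_e b₂`-end, i.e. `Φ_e(H_{w₂}) = k* H_{σ_e w₂} k*⁻¹`, and the branch clause element is again `1`.  No
normaliser or commensurator of `M_ε` is needed.  Nothing here takes a side on [IUTchIII] Cor 3.12; typed ≠
proved for Thm 5.4.
-/

namespace Literature.AnabelianGeometry.SemiGraphs

namespace SemiGraph

namespace SubgroupPresentation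

open CategoryTheory

universe u v

variable {𝔾 : SemiGraph.{u}} {Γ : Type u} [Group Γ] {E : Type v} [Group E]
  (P : SubgroupPresentation 𝔾 Γ) {Φ : E →* MulAut Γ} {σ : E →* Aut 𝔾}

/-! ### Conjugation bookkeeping on subgroups -/

section Bookkeeping

variable {Γ' : Type*} [Group Γ']

/-- `y (x K x⁻¹) y⁻¹ = (y x) K (y x)⁻¹`. [cite: MochizukiSemiAnbd2006, §5, p. 65] -/
theorem map_conj_map_conj' (K : Subgroup Γ') (x y : Γ') :
    (K.map (MulAut.conj x).toMonoidHom).map (MulAut.conj y).toMonoidHom =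
      K.map (MulAut.conj (y * x)).toMonoidHom := by
  rw [Subgroup.map_map]
  congr 1
  ext t
  simp only [MonoidHom.coe_comp, MulEquiv.coe_toMonoidHom, Function.comp_apply, MulAut.conj_apply]
  group

/-- `ψ (x K x⁻¹) = ψ(x) ψ(K) ψ(x)⁻¹` for an automorphism `ψ`. [cite: MochizukiSemiAnbd2006, §5, p. 65] -/
theorem map_conj_map_mulAut' (K : Subgroup Γ') (x : Γ') (ψ : MulAut Γ') :
    (K.map (MulAut.conj x).toMonoidHom).map ψ.toMonoidHom =
      (K.map ψ.toMonoidHom).map (MulAut.conj (ψ x)).toMonoidHom := by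
  rw [Subgroup.map_map, Subgroup.map_map]
  congr 1
  ext t
  simp only [MonoidHom.coe_comp, MulEquiv.coe_toMonoidHom, Function.comp_apply, MulAut.conj_apply,
    map_mul, map_inv]

/-- Conjugating by `1` does nothing. [cite: MochizukiSemiAnbd2006, §5, p. 65] -/
theorem map_conj_one' (K : Subgroup Γ') : K.map (MulAut.conj (1 : Γ')).toMonoidHom = K := by
  ext t
  simp

/-- Recover `ψ(K)` from `ψ(x K x⁻¹)`: `ψ(K) = ψ(x)⁻¹ ψ(x K x⁻¹) ψ(x)`. [cite: MochizukiSemiAnbd2006, §5, p. 65] -/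
theorem map_mulAut_eq_conj_inv' (K : Subgroup Γ') (x : Γ') (ψ : MulAut Γ') :
    K.map ψ.toMonoidHom =
      ((K.map (MulAut.conj x).toMonoidHom).map ψ.toMonoidHom).map (MulAut.conj (ψ x)⁻¹).toMonoidHom := by
  rw [map_conj_map_mulAut', map_conj_map_conj', inv_mul_cancel, map_conj_one']

/-- `x⁻¹ (x K x⁻¹) x = K`. [cite: MochizukiSemiAnbd2006, §5, p. 65] -/
theorem map_conj_map_conj_inv' (K : Subgroup Γ') (x : Γ') :
    (K.map (MulAut.conj x).toMonoidHom).map (MulAut.conj x⁻¹).toMonoidHom = K := by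
  rw [map_conj_map_conj', inv_mul_cancel, map_conj_one']

/-- Conjugation is injective on subgroups. [cite: MochizukiSemiAnbd2006, §5, p. 65] -/
theorem map_conj_injective' (x : Γ') {K K' : Subgroup Γ'}
    (h : K.map (MulAut.conj x).toMonoidHom = K'.map (MulAut.conj x).toMonoidHom) : K = K' :=
  Subgroup.map_injective (MulAut.conj x).injective h

/-- An automorphism is injective on subgroups. [cite: MochizukiSemiAnbd2006, §5, p. 65] -/
theorem map_mulAut_injective' (ψ : MulAut Γ') {K K' : Subgroup Γ'}
    (h : K.map ψ.toMonoidHom = K'.map ψ.toMonoidHom) : K = K' :=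
  Subgroup.map_injective ψ.injective h

end Bookkeeping

/-! ### The branch groups of a presentation lie in the positioned vertex groups -/

/-- `M_{ε} ≤ s_b⁻¹ H_w s_b` for a branch `b : ε → w` (the axiom `conj_mem` of a presentation, read as an
inclusion of subgroups). [cite: MochizukiSemiAnbd2006, §5, p. 65] -/
theorem M_le_map_conj_inv_s (b : 𝔾.Branch) (w : 𝔾.Vertex) (hw : 𝔾.abuts b = some w) :
    P.M (𝔾.edgeOf b) ≤ (P.H w).map (MulAut.conj (P.s b)⁻¹).toMonoidHom := by
  intro x hx
  refine ⟨P.s b * x * (P.s b)⁻¹, P.conj_mem b w hw x hx, ?_⟩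
  simp only [MulEquiv.coe_toMonoidHom, MulAut.conj_apply]
  group

/-- Branch maps of automorphisms of `𝔾` are injective. [cite: MochizukiSemiAnbd2006, §1 p.11] -/
theorem aut_branchMap_injective (τ : Aut 𝔾) : Function.Injective τ.hom.branchMap := by
  intro b b' h
  have h1 := congrArg Hom.branchMap τ.hom_inv_id
  rw [comp_branchMap, id_branchMap] at h1
  have hb := congrFun h1 b
  have hb' := congrFun h1 b'
  simp only [Function.comp_apply, id_eq] at hb hb'
  rw [← hb, ← hb', h]

/-! ### The edge conjugator from the pair transport -/

section PairTransport

variable (Φ σ)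

/-- **`Φ_e(M_ε) = m M_{σ_e ε} m⁻¹` for `m := Φ_e(s_b)⁻¹ · k · s_{σ_e b}`**, whenever `k` transports the pair
at the branch `b` of `ε`: the conjugation-form EDGE compatibility, as an EQUALITY.
[cite: MochizukiSemiAnbd2006, §5, p. 65] -/
theorem map_M_eq_of_pairTransport (e : E) (b : 𝔾.Branch) (k : Γ)
    (hk : ((P.M (𝔾.edgeOf b)).map (MulAut.conj (P.s b)).toMonoidHom).map (Φ e).toMonoidHom =
      ((P.M (𝔾.edgeOf ((σ e).hom.branchMap b))).map
        (MulAut.conj (P.s ((σ e).hom.branchMap b))).toMonoidHom).map (MulAut.conj k).toMonoidHom) :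
    (P.M (𝔾.edgeOf b)).map (Φ e).toMonoidHom =
      (P.M (𝔾.edgeOf ((σ e).hom.branchMap b))).map
        (MulAut.conj ((Φ e (P.s b))⁻¹ * k * P.s ((σ e).hom.branchMap b))).toMonoidHom := by
  rw [map_mulAut_eq_conj_inv' (P.M (𝔾.edgeOf b)) (P.s b) (Φ e), hk, map_conj_map_conj',
    map_conj_map_conj']

/-- Transport of a positioned vertex group: if `Φ_e(H_w) = k H_{w'} k⁻¹` then
`m⁻¹ Φ_e(s⁻¹ H_w s) m = (m⁻¹ Φ_e(s)⁻¹ k) H_{w'} (m⁻¹ Φ_e(s)⁻¹ k)⁻¹`. [cite: MochizukiSemiAnbd2006, §5, p. 65] -/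
theorem map_conj_inv_map_mulAut_map_conj' (H H' : Subgroup Γ) (ψ : MulAut Γ) (s k m : Γ)
    (hk : H.map ψ.toMonoidHom = H'.map (MulAut.conj k).toMonoidHom) :
    ((H.map (MulAut.conj s⁻¹).toMonoidHom).map ψ.toMonoidHom).map (MulAut.conj m⁻¹).toMonoidHom =
      H'.map (MulAut.conj (m⁻¹ * (ψ s)⁻¹ * k)).toMonoidHom := by
  rw [map_conj_map_mulAut', hk, map_conj_map_conj', map_conj_map_conj', map_inv ψ s]

/-- **Edge conjugators compatible with the branch elements, from the pair transport** — exactly the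
`hE` input of `IsArithCompatible.of_conj`: for every `e` and edge `ε` there is `m` with
`Φ_e(M_ε) ≤ m M_{σ_e ε} m⁻¹` and, for every branch `b : ε → w`, a vertex conjugator `k` at `w` with
`s_{σ_e b} · m⁻¹ · Φ_e(s_b)⁻¹ · k ∈ H_{σ_e w}` (module docstring for the construction).
[cite: MochizukiSemiAnbd2006, Thm 5.4, p. 66] -/
theorem exists_edgeConj_of_pairTransport
    (habuts : ∀ b : 𝔾.Branch, (𝔾.abuts b).isSome)
    (hV : ∀ (e : E) (w : 𝔾.Vertex), ∃ k : Γ,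
      (P.H w).map (Φ e).toMonoidHom = (P.H ((σ e).hom.vertexMap w)).map (MulAut.conj k).toMonoidHom)
    (hBR : ∀ (e : E) (b : 𝔾.Branch) (w : 𝔾.Vertex), 𝔾.abuts b = some w → ∃ k : Γ,
      (P.H w).map (Φ e).toMonoidHom = (P.H ((σ e).hom.vertexMap w)).map (MulAut.conj k).toMonoidHom ∧
      ((P.M (𝔾.edgeOf b)).map (MulAut.conj (P.s b)).toMonoidHom).map (Φ e).toMonoidHom =
        ((P.M (𝔾.edgeOf ((σ e).hom.branchMap b))).map
          (MulAut.conj (P.s ((σ e).hom.branchMap b))).toMonoidHom).map (MulAut.conj k).toMonoidHom)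
    (hTwo : ∀ (b₁ b₂ : 𝔾.Branch) (w₁ w₂ : 𝔾.Vertex), b₁ ≠ b₂ → 𝔾.edgeOf b₁ = 𝔾.edgeOf b₂ →
      𝔾.abuts b₁ = some w₁ → 𝔾.abuts b₂ = some w₂ → ∀ (w : 𝔾.Vertex) (g : Γ),
      P.M (𝔾.edgeOf b₁) ≤ (P.H w).map (MulAut.conj g).toMonoidHom →
        (P.H w).map (MulAut.conj g).toMonoidHom = (P.H w₁).map (MulAut.conj (P.s b₁)⁻¹).toMonoidHom ∨
        (P.H w).map (MulAut.conj g).toMonoidHom = (P.H w₂).map (MulAut.conj (P.s b₂)⁻¹).toMonoidHom)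
    (hNe : ∀ (b₁ b₂ : 𝔾.Branch) (w₁ w₂ : 𝔾.Vertex), b₁ ≠ b₂ → 𝔾.edgeOf b₁ = 𝔾.edgeOf b₂ →
      𝔾.abuts b₁ = some w₁ → 𝔾.abuts b₂ = some w₂ →
        (P.H w₁).map (MulAut.conj (P.s b₁)⁻¹).toMonoidHom ≠
          (P.H w₂).map (MulAut.conj (P.s b₂)⁻¹).toMonoidHom)
    (e : E) (ε : 𝔾.Edge) :
    ∃ m : Γ, (P.M ε).map (Φ e).toMonoidHom ≤
        (P.M ((σ e).hom.edgeMap ε)).map (MulAut.conj m).toMonoidHom ∧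
      ∀ (b : 𝔾.Branch) (w : 𝔾.Vertex), 𝔾.edgeOf b = ε → 𝔾.abuts b = some w →
        ∃ k : Γ, (P.H w).map (Φ e).toMonoidHom =
            (P.H ((σ e).hom.vertexMap w)).map (MulAut.conj k).toMonoidHom ∧
          P.s ((σ e).hom.branchMap b) * m⁻¹ * (Φ e (P.s b))⁻¹ * k ∈ P.H ((σ e).hom.vertexMap w) := by
  obtain ⟨b₁, b₂, h12, hb₁, hb₂, hall⟩ := 𝔾.two_branches ε
  obtain ⟨w₁, hw₁⟩ := Option.isSome_iff_exists.mp (habuts b₁)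
  obtain ⟨w₂, hw₂⟩ := Option.isSome_iff_exists.mp (habuts b₂)
  obtain ⟨k₁, hk₁H, hk₁M⟩ := hBR e b₁ w₁ hw₁
  -- the images of the branches / vertices / edge under `σ_e`
  have hε' : (σ e).hom.edgeMap ε = 𝔾.edgeOf ((σ e).hom.branchMap b₁) := by
    rw [(σ e).hom.edgeOf_branchMap, hb₁]
  have hb₁' : 𝔾.abuts ((σ e).hom.branchMap b₁) = some ((σ e).hom.vertexMap w₁) :=
    (σ e).hom.abuts_branchMap b₁ w₁ hw₁
  have hb₂' : 𝔾.abuts ((σ e).hom.branchMap b₂) = some ((σ e).hom.vertexMap w₂) :=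
    (σ e).hom.abuts_branchMap b₂ w₂ hw₂
  have h12' : (σ e).hom.branchMap b₁ ≠ (σ e).hom.branchMap b₂ :=
    fun h => h12 (aut_branchMap_injective (σ e) h)
  have hedge' : 𝔾.edgeOf ((σ e).hom.branchMap b₁) = 𝔾.edgeOf ((σ e).hom.branchMap b₂) := by
    rw [(σ e).hom.edgeOf_branchMap, (σ e).hom.edgeOf_branchMap, hb₁, hb₂]
  -- the edge conjugator (kept opaque)
  obtain ⟨m, hm⟩ : ∃ m : Γ, (Φ e (P.s b₁))⁻¹ * k₁ * P.s ((σ e).hom.branchMap b₁) = m := ⟨_, rfl⟩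
  have hM : (P.M ε).map (Φ e).toMonoidHom =
      (P.M ((σ e).hom.edgeMap ε)).map (MulAut.conj m).toMonoidHom := by
    rw [hε', ← hb₁, ← hm]
    exact P.map_M_eq_of_pairTransport Φ σ e b₁ k₁ hk₁M
  refine ⟨m, hM.le, fun b w hbε hbw => ?_⟩
  rcases hall b hbε with rfl | rfl
  · -- the branch used to define `m`: the element is `1`
    obtain rfl : w = w₁ := Option.some_injective _ (hbw.symm.trans hw₁)
    refine ⟨k₁, hk₁H, ?_⟩
    have : P.s ((σ e).hom.branchMap b) * m⁻¹ * (Φ e (P.s b))⁻¹ * k₁ = 1 := by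
      rw [← hm]; group
    rw [this]
    exact Subgroup.one_mem _
  · -- the other branch
    obtain rfl : w = w₂ := Option.some_injective _ (hbw.symm.trans hw₂)
    obtain ⟨k₂, hk₂⟩ := hV e w
    -- `W := m⁻¹ Φ_e(s_b⁻¹ H_w s_b) m` is the conjugate of `H_{σ w}` by `g`
    obtain ⟨g, hg⟩ : ∃ g : Γ, m⁻¹ * (Φ e (P.s b))⁻¹ * k₂ = g := ⟨_, rfl⟩
    have hW : (((P.H w).map (MulAut.conj (P.s b)⁻¹).toMonoidHom).map (Φ e).toMonoidHom).map
        (MulAut.conj m⁻¹).toMonoidHom =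
        (P.H ((σ e).hom.vertexMap w)).map (MulAut.conj g).toMonoidHom := by
      rw [← hg]
      exact map_conj_inv_map_mulAut_map_conj' _ _ (Φ e) (P.s b) k₂ m hk₂
    -- it contains `M_{σ ε} = m⁻¹ Φ_e(M_ε) m`
    have hMW : P.M (𝔾.edgeOf ((σ e).hom.branchMap b₁)) ≤
        (P.H ((σ e).hom.vertexMap w)).map (MulAut.conj g).toMonoidHom := by
      rw [← hW, ← hε']
      have h1 : P.M ((σ e).hom.edgeMap ε) =
          ((P.M ε).map (Φ e).toMonoidHom).map (MulAut.conj m⁻¹).toMonoidHom := by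
        rw [hM, map_conj_map_conj_inv']
      rw [h1]
      exact Subgroup.map_mono (Subgroup.map_mono (hbε ▸ P.M_le_map_conj_inv_s b w hbw))
    -- the `σ b₁`-end group is `m⁻¹ Φ_e(s_{b₁}⁻¹ H_{w₁} s_{b₁}) m`
    have hV₁' : (((P.H w₁).map (MulAut.conj (P.s b₁)⁻¹).toMonoidHom).map (Φ e).toMonoidHom).map
        (MulAut.conj m⁻¹).toMonoidHom =
        (P.H ((σ e).hom.vertexMap w₁)).map
          (MulAut.conj (P.s ((σ e).hom.branchMap b₁))⁻¹).toMonoidHom := by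
      rw [map_conj_inv_map_mulAut_map_conj' _ _ (Φ e) (P.s b₁) k₁ m hk₁H]
      have : m⁻¹ * (Φ e (P.s b₁))⁻¹ * k₁ = (P.s ((σ e).hom.branchMap b₁))⁻¹ := by
        rw [← hm]; group
      rw [this]
    rcases hTwo _ _ _ _ h12' hedge' hb₁' hb₂' ((σ e).hom.vertexMap w) g hMW with hcase | hcase
    · -- impossible: the two ends of `ε` would coincide
      exfalso
      refine hNe b₁ b w₁ w h12 (hb₁.trans hbε.symm) hw₁ hbw ?_
      rw [← hV₁', ← hW] at hcase
      exact (map_mulAut_injective' (Φ e) (map_conj_injective' m⁻¹ hcase)).symm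
    · -- `W` is the `σ b`-end: `k* := Φ_e(s_b) · m · s_{σ b}⁻¹` is a vertex conjugator at `w`
      refine ⟨Φ e (P.s b) * m * (P.s ((σ e).hom.branchMap b))⁻¹, ?_, ?_⟩
      · have h2 := congrArg (Subgroup.map (MulAut.conj (Φ e (P.s b) * m)).toMonoidHom) (hW.trans hcase)
        have hL : ((((P.H w).map (MulAut.conj (P.s b)⁻¹).toMonoidHom).map (Φ e).toMonoidHom).map
            (MulAut.conj m⁻¹).toMonoidHom).map (MulAut.conj (Φ e (P.s b) * m)).toMonoidHom =
            (P.H w).map (Φ e).toMonoidHom := by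
          rw [map_conj_map_mulAut' (P.H w) (P.s b)⁻¹ (Φ e), map_inv (Φ e) (P.s b),
            map_conj_map_conj', map_conj_map_conj']
          have : Φ e (P.s b) * m * m⁻¹ * (Φ e (P.s b))⁻¹ = 1 := by group
          rw [this, map_conj_one']
        have hR : ((P.H ((σ e).hom.vertexMap w)).map
              (MulAut.conj (P.s ((σ e).hom.branchMap b))⁻¹).toMonoidHom).map
              (MulAut.conj (Φ e (P.s b) * m)).toMonoidHom =
            (P.H ((σ e).hom.vertexMap w)).map
              (MulAut.conj (Φ e (P.s b) * m * (P.s ((σ e).hom.branchMap b))⁻¹)).toMonoidHom := by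
          rw [map_conj_map_conj']
        -- `h2` is `hL`'s left side = `hR`'s left side
        change ((((P.H w).map (MulAut.conj (P.s b)⁻¹).toMonoidHom).map (Φ e).toMonoidHom).map
            (MulAut.conj m⁻¹).toMonoidHom).map (MulAut.conj (Φ e (P.s b) * m)).toMonoidHom =
          ((P.H ((σ e).hom.vertexMap w)).map
              (MulAut.conj (P.s ((σ e).hom.branchMap b))⁻¹).toMonoidHom).map
              (MulAut.conj (Φ e (P.s b) * m)).toMonoidHom at h2
        rw [hL, hR] at h2
        exact h2
      · have : P.s ((σ e).hom.branchMap b) * m⁻¹ * (Φ e (P.s b))⁻¹ *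
            (Φ e (P.s b) * m * (P.s ((σ e).hom.branchMap b))⁻¹) = 1 := by group
        rw [this]
        exact Subgroup.one_mem _

/-- **`IsArithCompatible` from the pair transport**: abc-iut-L3-d4's conjugation-form constructor
`IsArithCompatible.of_conj` with its edge input `hE` DISCHARGED by `exists_edgeConj_of_pairTransport`;
remaining inputs: self-normalising vertex groups, a graph, edge groups = meets of the positioned vertex
groups (Thm 3.7 (iv) clause 2), vertex conjugators `hV`, pair transport `hBR`, two hosts `hTwo`, distinct
ends `hNe`. [cite: MochizukiSemiAnbd2006, Thm 5.4, p. 66] -/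
theorem isArithCompatible_of_pairTransport
    (hself : ∀ (w : 𝔾.Vertex) (n : Γ), (∀ x : Γ, x ∈ P.H w ↔ n⁻¹ * x * n ∈ P.H w) → n ∈ P.H w)
    (habuts : ∀ b : 𝔾.Branch, (𝔾.abuts b).isSome)
    (hedge : ∀ (b b' : 𝔾.Branch) (w w' : 𝔾.Vertex), b ≠ b' → 𝔾.edgeOf b = 𝔾.edgeOf b' →
      𝔾.abuts b = some w → 𝔾.abuts b' = some w' → ∀ x : Γ,
        x ∈ P.M (𝔾.edgeOf b) ↔ P.s b * x * (P.s b)⁻¹ ∈ P.H w ∧ P.s b' * x * (P.s b')⁻¹ ∈ P.H w')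
    (hV : ∀ (e : E) (w : 𝔾.Vertex), ∃ k : Γ,
      (P.H w).map (Φ e).toMonoidHom = (P.H ((σ e).hom.vertexMap w)).map (MulAut.conj k).toMonoidHom)
    (hBR : ∀ (e : E) (b : 𝔾.Branch) (w : 𝔾.Vertex), 𝔾.abuts b = some w → ∃ k : Γ,
      (P.H w).map (Φ e).toMonoidHom = (P.H ((σ e).hom.vertexMap w)).map (MulAut.conj k).toMonoidHom ∧
      ((P.M (𝔾.edgeOf b)).map (MulAut.conj (P.s b)).toMonoidHom).map (Φ e).toMonoidHom =
        ((P.M (𝔾.edgeOf ((σ e).hom.branchMap b))).map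
          (MulAut.conj (P.s ((σ e).hom.branchMap b))).toMonoidHom).map (MulAut.conj k).toMonoidHom)
    (hTwo : ∀ (b₁ b₂ : 𝔾.Branch) (w₁ w₂ : 𝔾.Vertex), b₁ ≠ b₂ → 𝔾.edgeOf b₁ = 𝔾.edgeOf b₂ →
      𝔾.abuts b₁ = some w₁ → 𝔾.abuts b₂ = some w₂ → ∀ (w : 𝔾.Vertex) (g : Γ),
      P.M (𝔾.edgeOf b₁) ≤ (P.H w).map (MulAut.conj g).toMonoidHom →
        (P.H w).map (MulAut.conj g).toMonoidHom = (P.H w₁).map (MulAut.conj (P.s b₁)⁻¹).toMonoidHom ∨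
        (P.H w).map (MulAut.conj g).toMonoidHom = (P.H w₂).map (MulAut.conj (P.s b₂)⁻¹).toMonoidHom)
    (hNe : ∀ (b₁ b₂ : 𝔾.Branch) (w₁ w₂ : 𝔾.Vertex), b₁ ≠ b₂ → 𝔾.edgeOf b₁ = 𝔾.edgeOf b₂ →
      𝔾.abuts b₁ = some w₁ → 𝔾.abuts b₂ = some w₂ →
        (P.H w₁).map (MulAut.conj (P.s b₁)⁻¹).toMonoidHom ≠
          (P.H w₂).map (MulAut.conj (P.s b₂)⁻¹).toMonoidHom) :
    P.IsArithCompatible Φ σ :=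
  IsArithCompatible.of_conj P hself habuts hedge hV
    (fun e ε => P.exists_edgeConj_of_pairTransport Φ σ habuts hV hBR hTwo hNe e ε)

end PairTransport

end SubgroupPresentation

end SemiGraph

end Literature.AnabelianGeometry.SemiGraphs
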